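import Mathlib
import HarnessLib
import HarnessLib.Audit
import Summits.AtomisticToContinuum.Statement
import Literature.MathematicalPhysics.StatisticalMechanics.BarlowStacking
import Literature.MathematicalPhysics.StatisticalMechanics.LennardJonesClusters
import Literature.Barriers.AtomisticToContinuum.LocalizedPotentialsExcludeLennardJones
import Literature.Geometry.DiscreteGeometry.KissingPatterns

/-!
Route: SteepnessLadderOneCentre

CLOSED (retired) 2026-08-15T13:46:58Z by operator:999:1257524 — reason: not-a-thesis: assembly does not conclude the sub-problem Statement — note: D-0027 §2.1 audit (human 2026-08-15: routes that do not decide the summit are removed): the assembly concludes `Literature.MathematicalPhysics.StatisticalMechanics.Crystallization`, not the sub-problem statement; a NEW conforming route may be opened from the same idea (generated `closes : … → _root_. The file is kept as the record of this route; refuted decls are indexed as negative knowledge (`ledger negatives`).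

# Route SteepnessLadderOneCentre — one-centre domination with one local transfer on the (2q,q)
steepness ladder — hcp crystallization in R^3 for q >= q0, LJ as the q = 6 endpoint

X ("it suffices to show") = COERCIVE ONE-CENTRE DOMINATION FOR LENNARD-JONES. Write E = −(1/(4q))
Σ_i Φ(x_i) with the one-centre
functional Φ(x) = Σ_{y≠x} φ_q(|x−y|), φ_q = 2r^{−q} − r^{−2q} = −V_q/|V_q(1)| (an identity; q = 6 is
Lennard-Jones). X: there are a
separation constant δ of LJ ground states and an hcp scale (a,h) such that for every ε and every R₀
some truncation radius R ≥ R₀ and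
ONE local, antisymmetric, finite-range transfer rule g give Φ^{≤R}(x) + T_g(x) ≤ Φ_hcp(a,h) + ε at
EVERY centre x of EVERY δ-separated
configuration, with a gain γ(η) at every centre whose (5a/3)-neighbourhood is not η-close (up to a
linear isometry) to the hcp
three-shell site environment. Spine card: steepness-ladder-one-centre — X is its (OC_q) at q = 6 in
truncated, transfer-inclusive form;
the route's ENGINE and measurable deliverable is the same inequality on the steepness ladder V_q =
r^{−2q}/(2q) − r^{−q}/q, q ≥ q₀
(crux OneCentreDomination), where the shells decouple exponentially and the inequality is proved
shell by shell (kissing cap,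
square-hole lemma, axial count); the soft hull-exactification cascade (card
hull-exactification-cascade H1) and the energy
bookkeeping are typed q-uniformly and instantiated at q = 6 in the Assembly (V₆ = mieWith (1/12)
(1/6) 12 6 = lennardJones).
Lean: `∃ δ a h : ℝ, 0 < δ ∧ 0 < a ∧ 0 < h ∧ (∀ (N : ℕ) (x : Fin N → EuclideanSpace ℝ (Fin 3)),
Literature.MathematicalPhysics.StatisticalMechanics.IsGroundState
(Literature.MathematicalPhysics.StatisticalMechanics.lennardJones) x → ∀ i j : Fin N, i ≠ j → δ ≤
dist (x i) (x j)) ∧ (∀ η : ℝ, 0 < η → ∃ γ : ℝ, 0 < γ ∧ ∀ ε : ℝ, 0 < ε → ∀ R₀ : ℝ, ∃ R : ℝ, R₀ ≤ R ∧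
∃ g : EuclideanSpace ℝ (Fin 3) → Set (EuclideanSpace ℝ (Fin 3)) → ℝ, (∀ (v : EuclideanSpace ℝ (Fin
3)) (U : Set (EuclideanSpace ℝ (Fin 3))), R < ‖v‖ → g v U = 0) ∧ ∀ S : Set (EuclideanSpace ℝ (Fin
3)), (∀ x ∈ S, ∀ y ∈ S, x ≠ y → δ ≤ dist x y) → (∀ x ∈ S, ∀ y ∈ S, g (y - x) (((fun z :
EuclideanSpace ℝ (Fin 3) => z - x) '' S) ∩ Metric.closedBall (0 : EuclideanSpace ℝ (Fin 3)) R) = - g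
(x - y) (((fun z : EuclideanSpace ℝ (Fin 3) => z - y) '' S) ∩ Metric.closedBall (0 : EuclideanSpace
ℝ (Fin 3)) R)) ∧ ∀ x ∈ S, ((∑' y : ↥S, (if dist x (y : EuclideanSpace ℝ (Fin 3)) ≤ R then (2 * (dist
x (y : EuclideanSpace ℝ (Fin 3)))⁻¹ ^ 6 - (dist x (y : EuclideanSpace ℝ (Fin 3)))⁻¹ ^ (2 * 6)) else
0)) + (∑' y : ↥S, g ((y : EuclideanSpace ℝ (Fin 3)) - x) (((fun z : EuclideanSpace ℝ (Fin 3) => z -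
x) '' S) ∩ Metric.closedBall (0 : EuclideanSpace ℝ (Fin 3)) R))) ≤ (∑' p :
↥(Literature.MathematicalPhysics.StatisticalMechanics.hcpStacking a h), (2 * (‖(p : EuclideanSpace ℝ
(Fin 3))‖)⁻¹ ^ 6 - (‖(p : EuclideanSpace ℝ (Fin 3))‖)⁻¹ ^ (2 * 6))) + ε ∧ (¬ (∃ A : EuclideanSpace ℝ
(Fin 3) →ₗᵢ[ℝ] EuclideanSpace ℝ (Fin 3), (∀ p ∈
Literature.MathematicalPhysics.StatisticalMechanics.hcpStacking a h, ‖p‖ ≤ 5 / 3 * a → ∃ y ∈ S, dist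
y (x + A p) ≤ η) ∧ (∀ y ∈ S, dist y x ≤ 5 / 3 * a → ∃ p ∈
Literature.MathematicalPhysics.StatisticalMechanics.hcpStacking a h, dist y (x + A p) ≤ η)) → ((∑' y
: ↥S, (if dist x (y : EuclideanSpace ℝ (Fin 3)) ≤ R then (2 * (dist x (y : EuclideanSpace ℝ (Fin
3)))⁻¹ ^ 6 - (dist x (y : EuclideanSpace ℝ (Fin 3)))⁻¹ ^ (2 * 6)) else 0)) + (∑' y : ↥S, g ((y :
EuclideanSpace ℝ (Fin 3)) - x) (((fun z : EuclideanSpace ℝ (Fin 3) => z - x) '' S) ∩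
Metric.closedBall (0 : EuclideanSpace ℝ (Fin 3)) R))) ≤ (∑' p :
↥(Literature.MathematicalPhysics.StatisticalMechanics.hcpStacking a h), (2 * (‖(p : EuclideanSpace ℝ
(Fin 3))‖)⁻¹ ^ 6 - (‖(p : EuclideanSpace ℝ (Fin 3))‖)⁻¹ ^ (2 * 6))) + ε - γ))`

## Assembly
Glue only: unpack X into (δ, a, h), LJ separation and coercive domination at q = 6; rewrite V₆ =
mieWith (1/(2·6)) (1/6) (2·6) 6 =
lennardJones (funext, simp, norm_num — checked in Sketch.lean); ZeroDensityOfDefects at q = 6 gives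
zero density of η-defective centres
for every η; ExactificationCascade at q = 6 gives IsCrystallizing; DominationEnergyLimit at q = 6
(fed with the non-coercive part of X,
η := 1, and with existence of LJ ground states = the PROVED fact
LennardJonesGroundStatesExist_holds) gives HasPeriodicGroundStateEnergy;
the conjunction is Crystallization. The rung theorem LadderCrystallizes assembles the same way from
OneCentreDomination + LadderGroundStates.

Rationale: WHY THIS LINE. Every proved crystallization theorem for realistic potentials is a narrow-well
theorem (HeitmannRadin1980, Theil2006, ELi2008 in d = 2;
FlatleyTheil2015 in d = 3 only WITH a three-body term), and the barrier
LocalizedPotentialsExcludeLennardJones shows one such step cannot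
reach (12,6); this line turns "narrowness" into the family's own exponent q and asks for a theorem
at q ≥ q₀ plus a certified descent,
instead of a class hypothesis that excludes the target. The engine is a POINTWISE bound on one
particle's view of the world — the 3-D
Heitmann–Radin count (kissing number, SchutteVanderwaerden1952 / Musin2005) made soft — corrected by
ONE local antisymmetric transfer in
the manner of Hales's local-inequality-with-transfers architecture (HalesDSP2012 Ch. 6–8), and it
decomposes shell by shell because on
the ladder the shell weights are 1 : 2^{−q/2} : (8/3)^{−q/2} : 3^{−q/2}: first shell = kissing cap,
second = the new square-hole lemma
(≤ 6 octahedral sites over any kissing shell, = 6 iff cubocta/anticubocta), third = axial count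
(Flatley–Theil's selector sign
V(√(8/3)) − 3V(√3) < 0 read at η = 0). Imported areas: discrete geometry of spherical codes
(kissing/Tammes, area method), the Flyspeck
transfer formalism, Radin's ground-state hull (Radin1991) for the soft exactification; no
probabilistic or spectral reformulation is
used (the statement is a T = 0 variational problem and the difficulty is pointwise geometric
frustration). Versus the open routes:
CrystalLocalRigidity (a) posits an abstract certified e_loc for LJ directly and
CrystalKissingRigidity bets on a ROBUST Fejes Tóth–Hales
theorem with linear rate; here e_loc is the explicit one-centre functional, the target family is the
ladder, and exactness of the limit
(two-way η-matching to the hcp environment at density → 0) replaces every robust-rigidity statement,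
so the only Hales-type input left is
the kissing number itself (unproved in Lean, hence crux #2) — the exact limit is identified by the
square-hole equality case and the
tree's PROVED HalesDSP_layerPackings_holds, not by Hales 2012 Thm 1 / flyspeck_L12.

RANKED CRUXES. #0 OneCentreDominationLJ (target) — X = COERCIVE ONE-CENTRE DOMINATION FOR
LENNARD-JONES (card steepness-ladder-one-centre, its (OC_q) at the summit value q = 6, in truncated
and transfer-inclusive form): there are δ > 0 separating all LJ ground states and an hcp scale (a,
h) such that for every ε and every R₀ there is R ≥ R₀ and ONE local antisymmetric transfer rule g of
range R (g sees the configuration in the R-ball of the giving particle) with, for every δ-separated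
S ⊂ ℝ³ and every x ∈ S: Φ_S^{≤R}(x) + T_g(x) ≤ Φ_hcp(a,h) + ε, where Φ_S^{≤R}(x) = Σ_{y∈S,|y−x|≤R}
φ₆(|x−y|), φ_q(r) = 2r^{−q} − r^{−2q} = −V_q(r)/|V_q(1)| (so E = −(1/(4q)) Σ_i Φ(x_i) exactly),
Φ_hcp(a,h) = Σ_{p∈hcp(a,h)∖0} φ₆(|p|) the hcp site value; and for every η a gain γ(η) > 0
(independent of ε, R) at every centre whose (5a/3)-neighbourhood is not η-matched, both ways and up
to a linear isometry, to the hcp three-shell site environment (12 at a, 6 at ≈√2·a, 2 axial at 2h).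
[difficulty: open-problem] (why it might fail: TetrahedralFrustration/IcosahedralClusters at q = 6:
ico and Frank–Kasper centres beat close-packed first shells by 4–8 % and the r⁻⁶ tail decouples only
geometrically, so a finite-range LOCAL rule may not collect enough nearby deficit (bare r⁻⁶ sum:
Mackay 14.7 > hcp 14.455).) [FlatleyTheil2015, BlancLewin2015, Blanc2004, Xue1997, HalesDSP2012]
#2 KissingNumberTwelve (crux) — THE KISSING NUMBER OF ℝ³ IS TWELVE: at most 12 unit vectors with
pairwise distances ≥ 1 (Schütte–van der Waerden; Leech; Musin; Bachoc–Vallentin). Load-bearing for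
the first-shell cap on every rung (with compactness: ∃ ε₁₂ > 0, no 13 points pairwise ≥ 1 in the
shell [1, 1+ε₁₂] — all the ladder needs since q₀ is free) and for every sphere-packing-heritage
route of the summit; UNPROVED IN LEAN (the tree has it only behind the named fact flyspeck_L12:
card_le_twelve_of_flyspeck_L12, not_packing_thirteen_of_L12). Filed as the route's FIRST crux by the
plancard rule (unproved cone fact ⇒ first crux explicitly) although it is a theorem in print; a
retriage may rebadge it support once a Lean proof lands. Card item S2. [difficulty: XL] (why it
might fail: Settled since 1952; the risk is formal SIZE: every proof (Schütte–van der Waerden,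
Leech+Maehara, Musin LP, Bachoc–Vallentin SDP, Hales L12) is computer-assisted or delicate spherical
geometry with no Mathlib support — XL, may starve the route of this input.)
[SchutteVanderwaerden1952, Musin2005, BachocVallentin2007, MusinTarasov2012, Hales2012]
#3 OneCentreDomination (crux) — THE LADDER ENGINE (card's OC_q; truncated + coercive + one local
transfer): there is q₀ such that for every q ≥ q₀, with V_q = r^{−2q}/(2q) − r^{−q}/q (= mieWith
(1/(2q)) (1/q) (2q) q; V₆ = Lennard-Jones), φ_q = 2r^{−q} − r^{−2q}, separation δ_q = 1 − 2/q, some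
hcp scale (a, h) (the V_q-optimal one) satisfies: ∀η ∃γ ∀ε ∀R₀ ∃R ≥ R₀ ∃ local antisymmetric range-R
rule g such that for every δ_q-separated S and x ∈ S, Σ_{y∈S,|y−x|≤R} φ_q(|y−x|) + T_g(x) ≤
Φ_hcp(q,a,h) + ε, improved by γ when the (5a/3)-neighbourhood of x is not η-hcp-like. Proof plan,
hierarchical because shell weights are 1 : ~2^{−q/2} : ~(8/3)^{−q/2} : ~3^{−q/2}: first shell ≤ 12
by KissingNumberTwelve + compactness (a bond stretched by ε₁₂ is worth (1 − (1+ε₁₂)^{−q})² → 0);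
second shell ≤ 6 by SquareHoleLemma (+ compactness); third shell = axial count ≤ 2, = 2 iff both
neighbouring layer pairs are h-type (Flatley–Theil's selector V(√(8/3)) − 3V(√3) read at η = 0 with
whole-layer sums: A₂ − B₂ = +4.3e−4 at q = 12); cramming down to δ_q is paid by the compressed pairs
through g (a pair at 1 − 2/q costs ≈ (e² − 1)² ≈ 40 well depths against an octahedral-site gain ≈
8·2^{−q/2}); stacking-order gains at x caused by faults within R are paid by the order-2 loss at the
fault; near the equality case first-order terms force a strain-linear part of g (t(x,y) =
−φ′(r)ê·(u_x + u_y) kills them at equilibrium) and pointwise positivity of the localised phonon form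
is part of the claim; beyond R nothing is claimed. Card items S4 (+S2, S3 as inputs). [deps:
KissingNumberTwelve, SquareHoleLemma, LadderGroundStates] [difficulty: L] (why it might fail:
Pointwise frustration: an icosahedral/Frank–Kasper or crammed centre (neighbours down to 1 − 2/q)
may beat the hcp value by more than a range-R LOCAL rule collects nearby; hcp is not the pointwise
max among Barlow sites at every layer order; the near field needs a positive localised phonon form.)
[FlatleyTheil2015, Theil2006, HalesDSP2012, BeterminSamajTravenec2022,
KusnerKusnerLagariasShlosman2018]
#4 SquareHoleLemma (crux) — SQUARE-HOLE LEMMA (exact form; slack by compactness; card item S3): T a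
kissing configuration (12 unit vectors pairwise ≥ 1), H a set of holes — points y with 1 ≤ |y| ≤ √2
at distance ≥ 1 from T and pairwise ≥ 1. Then #H ≤ 6, and #H = 6 forces T to be the cuboctahedron
(fcc pattern) or anticuboctahedron (hcp pattern) up to a linear isometry. Geometry: a hole at radius
r sees an empty cap of angular radius arccos(r/2) ≥ 45° in T; the 45°-circle carries ≤ 4 directions
pairwise ≥ 60° apart, = 4 iff an exact unit square; Euler (12 vertices, k quadrilateral + t = 20 −
2k triangular cells) with free-area bounds (regular unit square 1.359 sr, free part 0.335;
equilateral 60°-triangle 0.5514 sr, free part 0.0566; total free area 4π − 12·2π(1 − cos 30°) =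
2.463 sr) gives 7·0.335 + 6·0.0566 = 2.69 > 2.463 ⇒ k ≤ 6, and k = 6 exhausts the free area exactly
⇒ all cells regular ⇒ cubocta/anticubocta (cf. Hales2012_kissingConfigCongruent; area method of
HalesDSP Lemmas 6.103–6.111, tree CountingSpheresRegularPolygon). Second-shell cap of
OneCentreDomination (icosahedral shells host 0 holes) and the equality case that lets the exact
limit skip Hales 2012 Thm 1. [difficulty: M] (why it might fail: Thin area margins (2.69 vs 2.46 sr)
resting on unverified minimal-area claims for irregular cells (pentagons with two holes, holes at
radius < √2); a flexible KKLS 12-arrangement hosting 7 admissible holes refutes it; the equality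
case needs all-cells-regular ⇒ cubocta/anticubocta. Not in print.) [HalesDSP2012, Hales2012,
KusnerKusnerLagariasShlosman2018, MusinTarasov2012]
#5 ExactificationCascade (crux) — EXACTIFICATION CASCADE on the ladder (card item S5 = card
hull-exactification-cascade H1, specialised so that no Hales-2012 fact is needed): for q ≥ 4, if V_q
ground states are δ-separated and, for ONE hcp scale (a, h) and EVERY η > 0, the fraction of
particles whose (5a/3)-neighbourhood is not η-matched (both ways, up to a linear isometry) to the
hcp(a,h) site environment tends to 0 along every ground-state sequence, then IsCrystallizing V_q 3.
Plan (soft, no energy): δ-separation ⇒ ≤ C R³ particles per R-ball ⇒ by double counting some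
particle has no η_k-defect within R_k; translate it to 0; vague compactness of δ-separated
configurations, compactness of O(3) and closedness of the matching predicate give along a diagonal
subsequence a local limit S every point of which has its (5a/3)-environment EXACTLY isometric to the
hcp site environment; local-to-global rigidity (anticuboctahedral first shells force alternation;
ideal h: tree HalesDSP_layerPackings_holds; relaxed h: layers metrically distinguishable) ⇒ S ≅
hcpStacking a h = (isometryImage ∘ translate of hcpPeriodicConfiguration).points, multiplicity 1;
limits of limits are limits (Radin's hull is closed). [difficulty: M] (why it might fail: As typed:
two-way η-matching at the cut radius 5a/3 must survive vague limits, and local-to-global rigidity of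
RELAXED hcp(a,h) from 5a/3-environments must be reproved (tree covers ideal h only); a non-hcp
structure with all 5a/3-environments hcp-isometric would refute it (none expected).) [Radin1991,
BlancLewin2015, HalesDSP2012, Hales2012]
#9 ZeroDensityOfDefects (support) — ZERO DENSITY OF DEFECTIVE CENTRES from coercive domination (glue
X / OneCentreDomination → ExactificationCascade): for q ≥ 4, δ-separated ground states + coercive
domination at (q, δ, a, h) ⇒ for every η the fraction of η-defective centres → 0. Bookkeeping: E =
−(1/(4q)) Σ_i Φ(x_i) (two_mul_interactionEnergy); Σ_i T_g(x_i) = 0 (antisymmetry, finite S); 0 ≤ Φ −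
Φ^{≤R} ≤ ε_R(δ, q) → 0 (shell counting, q > 3); trial upper bound E(N) ≤ N e(hcp a h) + o(N) and
e(hcp a h) = −Φ_hcp/(4q) (mirror symmetry of the two motif sites); hence γ(η)·#defective ≤ N(ε +
ε_R) + o(N) with ε, R free after γ. [difficulty: M] [LucaFriesecke2016, Theil2006, BlancLewin2015]
#9 DominationEnergyLimit (support) — ENERGETIC CONJUNCT ON THE LADDER from the non-coercive part of
domination: for q ≥ 4, existence and δ-separation of V_q ground states + domination at (q, δ, a, h)
⇒ HasPeriodicGroundStateEnergy V_q 3 with P = hcpPeriodicConfiguration a h. Lower bound: transfers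
cancel, Φ ≤ Φ^{≤R} + ε_R ⇒ E(N)/N ≥ e(hcp a h) − (ε + ε_R)/(4q) for all ε, R. Upper bound: E(N) ≤ N
e(Q) + o(N) for every periodic Q by trial blocks (tails summable, q ≥ 4 > 3;
PeriodicConfigurationSums.summable_inv_pow_dist), in particular Q = hcp(a,h): E(N)/N → e(hcp a h)
and e(hcp a h) ≤ e(Q) for all Q (IsLeast) — no compactness over lattices needed, the dominating
configuration is explicit. At q = 6 existence is the proved fact
LennardJonesGroundStatesExist_holds. [difficulty: M] [BlancLewin2015, Theil2006]
#9 LadderGroundStates (support) — GROUND STATES ON THE LADDER EXIST AND ARE (1 − 2/q)-SEPARATED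
(card item S1, explicit form): for q ≥ q₀, E(N) has minimisers for every N (binding inequalities, as
LennardJonesGroundStatesExist_holds) and every ground state of V_q has all distances ≥ 1 − 2/q
(removal argument: site energies ≤ 0 in a ground state; a pair at r ≤ 1 − 2/q contributes ≈ (e⁴/2 −
e²)/q ≈ 19.9/q against ≤ (#particles within ~1.3)·1/(2q) + tail of attraction, the count bounded
after an a-priori crude separation as in LennardJonesMinimalDistance_holds). The tree's LJ facts are
q = 6 and qualitative; OneCentreDomination is stated at δ_q = 1 − 2/q, so the explicit constant is
needed. [difficulty: M] [Blanc2004, Xue1997, BlancLewin2015]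
#9 LadderCrystallizes (support) — THE RUNG THEOREM (corollary of OneCentreDomination +
LadderGroundStates + ZeroDensityOfDefects + ExactificationCascade + DominationEnergyLimit): there is
q₀ such that for all q ≥ q₀ the (2q, q) potential V_q = r^{−2q}/(2q) − r^{−q}/q crystallizes in ℝ³
in both Blanc–Lewin senses, onto hcp at its optimal scale — the first crystallization theorem in ℝ³
for a pure, smooth, LJ-shaped PAIR potential (FlatleyTheil2015 Thm 1.1 needs a three-body term;
Theil2006 / ELi2008 are d = 2; BeterminSamajTravenec2022 treat lattice energies only; status:
BlancLewin2015 §2.3, Kreutz–Ziereis arXiv:2604.19239 §1). q₀ (and later the first failing q_c of the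
pointwise bound) is the route's computable measure of progress toward q = 6. Support (corollary) so
that staffing keys on the cruxes. [difficulty: L] [FlatleyTheil2015, Theil2006, ELi2008,
BeterminSamajTravenec2022, BlancLewin2015, arXiv:2604.19239]

TWO-LAYER PLAN. Foreseen glued splits (nothing filed now; k ≤ 3, depth 1): OneCentreDomination ⇐
FirstShellCap (kissing + compactness + cramming
transfer) → OuterShellBound (square-hole + axial + tail, with the inter-layer transfer) →
OneCentreDomination, or by regime
OneCentreDomination ⇐ NearField (strain-linear transfer + localised phonon positivity within η₀ of
hcp) → FarFromHcp (gap γ outside η₀)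
→ OneCentreDomination; SquareHoleLemma ⇐ CountBound (≤ 6 by the area method) → EqualityCase (6 ⇒
regular cells ⇒ cubocta/anticubocta)
→ SquareHoleLemma; ExactificationCascade ⇐ ExactLimitExists (diagonal hull limit with exact
environments) → LocalToGlobalHcp (relaxed
hcp rigidity from 5a/3-environments) → ExactificationCascade. X itself is attacked only after the
rung: its first child would be the
descent table q ↦ margin of the pointwise bound and the first failing q_c.

KILL CRITERIA. OneCentreDomination refuted for EVERY q (a family of δ_q-separated configurations,
one per q, whose centre beats Φ_hcp(q) by more than any
range-R local rule can collect — e.g. a Frank–Kasper environment winning pointwise at all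
steepnesses) closes the route
(`close --reason refuted:OneCentreDomination`): the one-centre mechanism is dead at every rung.
OneCentreDomination refuted only below
some q_c but proved above: the route has delivered the rung theorem; X (q = 6) is then restated with
multi-centre cells (pivot, new decl)
or handed to the certificate routes (frustration-range-lp-hierarchy / equality-free-certificates
cards). SquareHoleLemma refuted (7 holes
over a flexible kissing shell): pivot the second-shell step to an L12-type weighted count (needs
flyspeck_L12) — the ladder survives with
a worse q₀, elegance lost. ExactificationCascade refuted as typed: restate (matching radius /
closedness), not a kill. X refuted directly
(an LJ configuration family defeating every finite-range local rule at q = 6) kills the summit claim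
of THIS line but not the rung.
KissingNumberTwelve cannot be refuted; if it starves (no Lean proof in sight) the whole
sphere-packing heritage of the summit is blocked,
not just this route. CrysPeriodicMinAttained (0627) refuted elsewhere refutes the conjunct itself.

NOT DECOMPOSED YET. The explicit transfer rule g (compressed-pair charging, inter-layer shipping,
strain-linear near-field part) and its range R(ε); the
value of q₀ and the descent table q ↦ (margin, d*(q), δ_q); effective slack versions of
KissingNumberTwelve / SquareHoleLemma (only the
exact statements + compactness are needed for ∃ q₀); the axial-site lemma as a separate statement
(it is a two-line count once the first
two shells are exact, kept inside OneCentreDomination); the trial-state upper bound and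
tail/shell-counting constants (inside the two
support lemmas); relaxed-hcp local-to-global rigidity (inside ExactificationCascade); everything
specific to q = 6 beyond X itself
(multi-centre cells, certified LP/SDP duals) — deliberately left until the rung closes or q_c is
located.

CHEAPEST FALSIFIER. Basin-hopping / random-restart maximisation of the truncated one-centre sum
Σ_{|y−x|≤3} φ_q(|y−x|) over δ_q-separated clusters of ≤ 60
points around a centre, for q = 40, 24, 12 (then 9, 6), against Φ_hcp(q) at the optimal hcp scale
PLUS the total deficit available within
R = 3 (the most any transfer could ship): one centre beating that kills the rung at that q (card's
own uncertified numbers: Φ_hcp(12) =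
12.259 vs Mackay 12.11, anti-Mackay ≤ 12.18; at (12,6) hcp 15.83 vs Mackay 14.95 at uniform scale —
the cramming direction is untested).
Second, cheaper still: maximise the number of admissible holes over (S²)¹² × shell configurations
(SquareHoleLemma) by random restarts —
a 7-hole configuration kills crux #4 in minutes. Neither was run in this planning session (hub is
compute-free; no kit job submitted).

NUMBERS. φ_q(r) = 2r^{−q} − r^{−2q}, |V_q(1)| = 1/(2q); hcp shells (ideal): 12 at 1, 6 at √2, 2 at
√(8/3) = 1.633, 18 at √3, 12 at √(11/3), 6 at 2;
matching radius 5a/3 = 1.667a sits between 2h = 1.633a and √3·a = 1.732a. One-centre values (card,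
uncertified, cutoff 2.1 d_nn, optimal
uniform scale): (24,12): Φ_hcp 12.259, Φ_fcc 12.258, Mackay centre 12.11, anti-Mackay 12.13–12.18;
(18,9): 12.92 vs 12.6–12.8; (12,6):
hcp 15.83, fcc 15.76, Mackay 14.95. Whole-layer second-order stacking difference at q = 12: A₂ − B₂
≈ +4.3e−4 (h-alignment favoured;
brittle-rung card: J₂^{(p)} < 0 for p ∈ [5,30], domination ratio 311 → 6e5). Tammes 13: 57.1367° ⇒
no 13 points pairwise ≥ d in the
shell [d, 1.0455d] (MusinTarasov2012); L12 numerics: 1.0199 (tree card_le_twelve_of_norm_le).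
Square-hole areas: unit square cell 1.359 sr
(free 0.335), 60°-triangle 0.5514 sr (free 0.0566), free total 2.463 sr. Separation: δ_q = 1 − 2/q,
pair cost at δ_q ≈ (e² − 1)² ≈ 40
well depths (q → ∞). Items at open: 10 (1 target, 4 cruxes, 4 support, 1 assembly).

DEFINITION REQUESTS. None needed to elaborate: mieWith (Literature.Barriers.AtomisticToContinuum),
hcpStacking / hcpPeriodicConfiguration
(StatisticalMechanics.BarlowStacking), fccKissingPattern / hcpKissingPattern
(DiscreteGeometry.KissingPatterns), IsGroundState /
HasPeriodicGroundStateEnergy / IsCrystallizing exist. Nice-to-have later (not filed): `oneCentreSum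
q S R x` and `hcpSiteValue q a h`
as named defs under Summits/AtomisticToContinuum/Crystallization/Theorems to shorten the four items
that inline the domination template.

Novelty: Searches (2026-08-15, this session; remote APIs partly rate-limited): `lit frontier
AtomisticToContinuum --since 2020` (30 rows, none on
3-D pair-potential crystallization); `lit search --hybrid "number of octahedral interstices around a
sphere in a packing with twelve
neighbours"` (8 book hits: HalesDSP2012, ConwaySloane1999, Coxeter — no hole-count lemma); `lit
galaxy search "twelve neighbours
octahedral sites at most six kissing" --star all` (0); `lit search --source crossref
"crystallization three dimensions Lennard-Jones"
--year-from 2022` (13, none relevant: Crismale–Kubin–Ninno–Ponsiglione 2023 is 1-D generalized LJ);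
openalex/arxiv 429, zbmath/s2 0 rows;
plus the card's audited searches (refuter-novelty-audit-…-3-0: zbMATH 'lower bound interatomic
distance LJ clusters', crossref
Schachinger, vsearch one-centre kissing bound).
Nearest prior art found: FlatleyTheil2015 (arXiv:1407.0692: d = 3 narrow well WITH three-body term;
selector sign at √(8/3), √3; Conj. 2.2),
Theil2006 / ELi2008 (d = 2 one-step narrow-well scheme), BeterminSamajTravenec2022
(arXiv:2107.14020: exponent families, LATTICE energies
only), Hales2012 Lemma 1 + MusinTarasov2012 (kissing caps), HalesDSP2012 Ch. 6–8 (local inequality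
with transfers, for density not energy),
Radin1991 (hull). Sibling in-pool lines: card brittle-rung-mie-descent (same family and target,
engine = Tammes one-shell count + LOCAL
Hales 2012 + compactness, i.e. needs Hales2012_kissingTwelve/flyspeck_L12; this route needs only th  [refs: 1407.0692, 2107.14020, HalesDSP2012, ConwaySloane1999, FlatleyTheil2015, Theil2006, ELi2008, BeterminSamajTravenec2022, Hales2012, MusinTarasov2012, Radin1991]

Barriers (technique_class: narrow-well one-centre-bound heitmann-radin-transplant-3d): - technique_class: narrow-well one-centre-bound heitmann-radin-transplant-3d
- Literature.Barriers.AtomisticToContinuum.LocalizedPotentialsExcludeLennardJones: APPLIES in spirit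
— every rung q ≥ q₀ is a narrow-well theorem and (12,6) is provably outside Theil's and
Flatley–Theil's classes; evaded formally (nothing is instantiated from Theil2006.IsAdmissible /
FlatleyTheil2015.IsLocalizedPair: the family's own exponent is the parameter and OneCentreDomination
is re-proved per q) and conceded substantively: the summit needs X at q = 6, reached only by
descent; the bet is that the pointwise bound with transfers survives to q_c ≤ 6 or names q_c.
- Literature.Barriers.AtomisticToContinuum.TetrahedralFrustration: APPLIES — a one-centre bound is a
single-cell bound and pure single-cell density bounds fail in ℝ³ (Rogers 0.7797, dodecahedral
0.755); evaded on the ladder because the scored quantity is ENERGY with an exponentially narrow well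
(a regular-tetrahedral/icosahedral environment gains nothing in the first shell — ≤ 12 bonds either
way — and LOSES the 6 octahedral second-shell sites, worth 6·2^{1−q/2} ≫ anything beyond), plus one
transfer (Hales's own remedy, hybrid scoring); at q = 6 it bites and is the declared risk of X.
- Literature.Barriers.AtomisticToContinuum.IcosahedralClusters: APPLIES to any first-shell-only
inequality (ico shells win ≈4 % at q = 6, ≈8.4 % for 13-atom clusters); evaded by scoring two to
three shells (icosahedral shells host 0 square holes: SquareHoleL

History (route lifecycle, newest last):
- 2026-08-15T13:46:58Z · CLOSED retired — not-a-thesis: assembly does not conclude the sub-problem Statement (operator:999:1257524)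

sub-problem: Crystallization · status: closed(retired) · opened planner-plancard-AtomisticToContinuum-Crystal-0ba36546-0 2026-08-15T11:21:05Z · rev 0 · ledger route-AtomisticToContinuum-SteepnessLadderOneCentre
GENERATED by the gate from the ledger (D-0016/17). Provers cite these decls: `theorem foo : Summit.AtomisticToContinuum.Crystallization.Theses.SteepnessLadderOneCentre.<Decl> := …` in Summits/AtomisticToContinuum/Crystallization/Theorems/<Name>.lean.
-/

namespace Summit.AtomisticToContinuum.Crystallization.Theses.SteepnessLadderOneCentre

open scoped BigOperators Topology Manifold Classical MeasureTheory ProbabilityTheory Matrix InnerProductSpace ComplexConjugate ContinuousMap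
open Filter Set Function TopologicalSpace MeasureTheory

attribute [summit_statement] _root_.Crystallization

/-- item stmt-AtomisticToContinuum-3616 · target · rank 0 · closed · moot by None · by planner
why it might fail: TetrahedralFrustration/IcosahedralClusters at q = 6: ico and Frank–Kasper centres beat close-packed first shells by 4–8 % and the r⁻⁶ tail decouples only geometrically, so a finite-range LOCAL rule may not collect enough nearby deficit (bare r⁻⁶ sum: Mackay 14.7 > hcp 14.455).
sources: FlatleyTheil2015, BlancLewin2015, Blanc2004, Xue1997, HalesDSP2012
[target] X = COERCIVE ONE-CENTRE DOMINATION FOR LENNARD-JONES (card steepness-ladder-one-centre, its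
(OC_q) at the summit value q = 6, in truncated and transfer-inclusive form): there are δ > 0
separating all LJ ground states and an hcp scale (a, h) such that for every ε and every R₀ there is
R ≥ R₀ and ONE local antisymmetric transfer rule g of range R (g sees the configuration in the
R-ball of the giving particle) with, for every δ-separated S ⊂ ℝ³ and every x ∈ S: Φ_S^{≤R}(x) +
T_g(x) ≤ Φ_hcp(a,h) + ε, where Φ_S^{≤R}(x) = Σ_{y∈S,|y−x|≤R} φ₆(|x−y|), φ_q(r) = 2r^{−q} − r^{−2q} =
−V_q(r)/|V_q(1)| (so E = −(1/(4q)) Σ_i Φ(x_i) exactly), Φ_hcp(a,h) = Σ_{p∈hcp(a,h)∖0} φ₆(|p|) the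
hcp site value; and for every η a gain γ(η) > 0 (independent of ε, R) at every centre whose
(5a/3)-neighbourhood is not η-matched, both ways and up to a linear isometry, to the hcp three-shell
site environment (12 at a, 6 at ≈√2·a, 2 axial at 2h). [difficulty: open-problem] -/
@[route_item "route-AtomisticToContinuum-SteepnessLadderOneCentre"]
def OneCentreDominationLJ : Prop :=
  ∃ δ a h : ℝ, 0 < δ ∧ 0 < a ∧ 0 < h ∧ (∀ (N : ℕ) (x : Fin N → EuclideanSpace ℝ (Fin 3)), Literature.MathematicalPhysics.StatisticalMechanics.IsGroundState (Literature.MathematicalPhysics.StatisticalMechanics.lennardJones) x → ∀ i j : Fin N, i ≠ j → δ ≤ dist (x i) (x j)) ∧ (∀ η : ℝ, 0 < η → ∃ γ : ℝ, 0 < γ ∧ ∀ ε : ℝ, 0 < ε → ∀ R₀ : ℝ, ∃ R : ℝ, R₀ ≤ R ∧ ∃ g : EuclideanSpace ℝ (Fin 3) → Set (EuclideanSpace ℝ (Fin 3)) → ℝ, (∀ (v : EuclideanSpace ℝ (Fin 3)) (U : Set (EuclideanSpace ℝ (Fin 3))), R < ‖v‖ → g v U = 0) ∧ ∀ S : Set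 (EuclideanSpace ℝ (Fin 3)), (∀ x ∈ S, ∀ y ∈ S, x ≠ y → δ ≤ dist x y) → (∀ x ∈ S, ∀ y ∈ S, g (y - x) (((fun z : EuclideanSpace ℝ (Fin 3) => z - x) '' S) ∩ Metric.closedBall (0 : EuclideanSpace ℝ (Fin 3)) R) = - g (x - y) (((fun z : EuclideanSpace ℝ (Fin 3) => z - y) '' S) ∩ Metric.closedBall (0 : EuclideanSpace ℝ (Fin 3)) R)) ∧ ∀ x ∈ S, ((∑' y : ↥S, (if dist x (y : EuclideanSpace ℝ (Fin 3)) ≤ R then (2 * (dist x (y : EuclideanSpace ℝ (Fin 3)))⁻¹ ^ 6 - (dist x (y : EuclideanSpace ℝ (Fin 3)))⁻¹ ^ (2 * 6)) else 0)) + (∑' y : ↥S, g ((y : EuclideanSpace ℝ (Fin 3)) - x) (((fun z : EuclideanSpace ℝ (Fin 3) => z - x) '' S) ∩ Metric.closedBall (0 : EuclideanSpace ℝ (Fin 3)) R))) ≤ (∑' p : ↥(Literature.MathematicalPhysics.StatisticalMechanics.hcpStacking a h), (2 * (‖(p : EuclideanSpace ℝ (Fin 3))‖)⁻¹ ^ 6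 - (‖(p : EuclideanSpace ℝ (Fin 3))‖)⁻¹ ^ (2 * 6))) + ε ∧ (¬ (∃ A : EuclideanSpace ℝ (Fin 3) →ₗᵢ[ℝ] EuclideanSpace ℝ (Fin 3), (∀ p ∈ Literature.MathematicalPhysics.StatisticalMechanics.hcpStacking a h, ‖p‖ ≤ 5 / 3 * a → ∃ y ∈ S, dist y (x + A p) ≤ η) ∧ (∀ y ∈ S, dist y x ≤ 5 / 3 * a → ∃ p ∈ Literature.MathematicalPhysics.StatisticalMechanics.hcpStacking a h, dist y (x + A p) ≤ η)) → ((∑' y : ↥S, (if dist x (y : EuclideanSpace ℝ (Fin 3)) ≤ R then (2 * (dist x (y : EuclideanSpace ℝ (Fin 3)))⁻¹ ^ 6 - (dist x (y : EuclideanSpace ℝ (Fin 3)))⁻¹ ^ (2 * 6)) else 0)) + (∑' y : ↥S, g ((y : EuclideanSpace ℝ (Fin 3)) - x) (((fun z : EuclideanSpace ℝ (Fin 3) => z - x) '' S) ∩ Metric.closedBall (0 : EuclideanSpace ℝ (Fin 3)) R))) ≤ (∑' p : ↥(Literature.MathematicalPhysics.StatisticalMechanics.hcpStacking a h), (2 *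 (‖(p : EuclideanSpace ℝ (Fin 3))‖)⁻¹ ^ 6 - (‖(p : EuclideanSpace ℝ (Fin 3))‖)⁻¹ ^ (2 * 6))) + ε - γ))

/-- item stmt-AtomisticToContinuum-3617 · crux · rank 2 · closed · moot by None · by planner
why it might fail: Settled since 1952; the risk is formal SIZE: every proof (Schütte–van der Waerden, Leech+Maehara, Musin LP, Bachoc–Vallentin SDP, Hales L12) is computer-assisted or delicate spherical geometry with no Mathlib support — XL, may starve the route of this input.
sources: SchutteVanderwaerden1952, Musin2005, BachocVallentin2007, MusinTarasov2012, Hales2012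
[crux] THE KISSING NUMBER OF ℝ³ IS TWELVE: at most 12 unit vectors with pairwise distances ≥ 1
(Schütte–van der Waerden; Leech; Musin; Bachoc–Vallentin). Load-bearing for the first-shell cap on
every rung (with compactness: ∃ ε₁₂ > 0, no 13 points pairwise ≥ 1 in the shell [1, 1+ε₁₂] — all the
ladder needs since q₀ is free) and for every sphere-packing-heritage route of the summit; UNPROVED
IN LEAN (the tree has it only behind the named fact flyspeck_L12: card_le_twelve_of_flyspeck_L12,
not_packing_thirteen_of_L12). Filed as the route's FIRST crux by the plancard rule (unproved cone
fact ⇒ first crux explicitly) although it is a theorem in print; a retriage may rebadge it support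
once a Lean proof lands. Card item S2. [difficulty: XL] -/
@[route_item "route-AtomisticToContinuum-SteepnessLadderOneCentre"]
def KissingNumberTwelve : Prop :=
  ∀ T : Finset (EuclideanSpace ℝ (Fin 3)), (∀ v ∈ T, ‖v‖ = 1) → (∀ v ∈ T, ∀ w ∈ T, v ≠ w → 1 ≤ dist v w) → T.card ≤ 12

/-- item stmt-AtomisticToContinuum-3618 · crux · rank 3 · closed · moot by None · by planner
why it might fail: Pointwise frustration: an icosahedral/Frank–Kasper or crammed centre (neighbours down to 1 − 2/q) may beat the hcp value by more than a range-R LOCAL rule collects nearby; hcp is not the pointwise max among Barlow sites at every layer order; the near field needs a positive localised phonon form.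
sources: FlatleyTheil2015, Theil2006, HalesDSP2012, BeterminSamajTravenec2022, KusnerKusnerLagariasShlosman2018
[crux] THE LADDER ENGINE (card's OC_q; truncated + coercive + one local transfer): there is q₀ such
that for every q ≥ q₀, with V_q = r^{−2q}/(2q) − r^{−q}/q (= mieWith (1/(2q)) (1/q) (2q) q; V₆ =
Lennard-Jones), φ_q = 2r^{−q} − r^{−2q}, separation δ_q = 1 − 2/q, some hcp scale (a, h) (the
V_q-optimal one) satisfies: ∀η ∃γ ∀ε ∀R₀ ∃R ≥ R₀ ∃ local antisymmetric range-R rule g such that for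
every δ_q-separated S and x ∈ S, Σ_{y∈S,|y−x|≤R} φ_q(|y−x|) + T_g(x) ≤ Φ_hcp(q,a,h) + ε, improved by
γ when the (5a/3)-neighbourhood of x is not η-hcp-like. Proof plan, hierarchical because shell
weights are 1 : ~2^{−q/2} : ~(8/3)^{−q/2} : ~3^{−q/2}: first shell ≤ 12 by KissingNumberTwelve +
compactness (a bond stretched by ε₁₂ is worth (1 − (1+ε₁₂)^{−q})² → 0); second shell ≤ 6 by
SquareHoleLemma (+ compactness); third shell = axial count ≤ 2, = 2 iff both neighbouring layer
pairs are h-type (Flatley–Theil's selector V(√(8/3)) − 3V(√3) read at η = 0 with whole-layer sums: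
A₂ − B₂ = +4.3e−4 at q = 12); cramming down to δ_q is paid by the compressed pairs through g (a pair
at 1 − 2/q costs ≈ (e² − 1)² ≈ 40 well depths against an octahedral-site gain ≈ 8·2^{−q/2});
stacking-order gains at x caused by -/
@[route_item "route-AtomisticToContinuum-SteepnessLadderOneCentre"]
def OneCentreDomination : Prop :=
  ∃ q₀ : ℕ, ∀ q : ℕ, q₀ ≤ q → ∃ a h : ℝ, 0 < a ∧ 0 < h ∧ (∀ η : ℝ, 0 < η → ∃ γ : ℝ, 0 < γ ∧ ∀ ε : ℝ, 0 < ε → ∀ R₀ : ℝ, ∃ R : ℝ, R₀ ≤ R ∧ ∃ g : EuclideanSpace ℝ (Fin 3) → Set (EuclideanSpace ℝ (Fin 3)) → ℝ, (∀ (v : EuclideanSpace ℝ (Fin 3)) (U : Set (EuclideanSpace ℝ (Fin 3))), R < ‖v‖ → g v U = 0) ∧ ∀ S : Set (EuclideanSpace ℝ (Fin 3)), (∀ x ∈ S, ∀ y ∈ S, x ≠ y → (1 - 2 / (q : ℝ)) ≤ dist x y) → (∀ x ∈ S, ∀ y ∈ S, g (y - x) (((fun z : EuclideanSpace ℝ (Fin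 3) => z - x) '' S) ∩ Metric.closedBall (0 : EuclideanSpace ℝ (Fin 3)) R) = - g (x - y) (((fun z : EuclideanSpace ℝ (Fin 3) => z - y) '' S) ∩ Metric.closedBall (0 : EuclideanSpace ℝ (Fin 3)) R)) ∧ ∀ x ∈ S, ((∑' y : ↥S, (if dist x (y : EuclideanSpace ℝ (Fin 3)) ≤ R then (2 * (dist x (y : EuclideanSpace ℝ (Fin 3)))⁻¹ ^ q - (dist x (y : EuclideanSpace ℝ (Fin 3)))⁻¹ ^ (2 * q)) else 0)) + (∑' y : ↥S, g ((y : EuclideanSpace ℝ (Fin 3)) - x) (((fun z : EuclideanSpace ℝ (Fin 3) => z - x) '' S) ∩ Metric.closedBall (0 : EuclideanSpace ℝ (Fin 3)) R))) ≤ (∑' p : ↥(Literature.MathematicalPhysics.StatisticalMechanics.hcpStacking a h), (2 * (‖(p : EuclideanSpace ℝ (Fin 3))‖)⁻¹ ^ q - (‖(p : EuclideanSpace ℝ (Fin 3))‖)⁻¹ ^ (2 * q))) + ε ∧ (¬ (∃ A : EuclideanSpace ℝ (Fin 3) →ₗᵢ[ℝ] EuclideanSpace ℝ (Fin 3), (∀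 p ∈ Literature.MathematicalPhysics.StatisticalMechanics.hcpStacking a h, ‖p‖ ≤ 5 / 3 * a → ∃ y ∈ S, dist y (x + A p) ≤ η) ∧ (∀ y ∈ S, dist y x ≤ 5 / 3 * a → ∃ p ∈ Literature.MathematicalPhysics.StatisticalMechanics.hcpStacking a h, dist y (x + A p) ≤ η)) → ((∑' y : ↥S, (if dist x (y : EuclideanSpace ℝ (Fin 3)) ≤ R then (2 * (dist x (y : EuclideanSpace ℝ (Fin 3)))⁻¹ ^ q - (dist x (y : EuclideanSpace ℝ (Fin 3)))⁻¹ ^ (2 * q)) else 0)) + (∑' y : ↥S, g ((y : EuclideanSpace ℝ (Fin 3)) - x) (((fun z : EuclideanSpace ℝ (Fin 3) => z - x) '' S) ∩ Metric.closedBall (0 : EuclideanSpace ℝ (Fin 3)) R))) ≤ (∑' p : ↥(Literature.MathematicalPhysics.StatisticalMechanics.hcpStacking a h), (2 * (‖(p : EuclideanSpace ℝ (Fin 3))‖)⁻¹ ^ q - (‖(p : EuclideanSpace ℝ (Fin 3))‖)⁻¹ ^ (2 * q))) + ε - γ))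

/-- item stmt-AtomisticToContinuum-3619 · crux · rank 4 · closed · moot by None · by planner
why it might fail: Thin area margins (2.69 vs 2.46 sr) resting on unverified minimal-area claims for irregular cells (pentagons with two holes, holes at radius < √2); a flexible KKLS 12-arrangement hosting 7 admissible holes refutes it; the equality case needs all-cells-regular ⇒ cubocta/anticubocta. Not in print.
sources: HalesDSP2012, Hales2012, KusnerKusnerLagariasShlosman2018, MusinTarasov2012
[crux] SQUARE-HOLE LEMMA (exact form; slack by compactness; card item S3): T a kissing configuration
(12 unit vectors pairwise ≥ 1), H a set of holes — points y with 1 ≤ |y| ≤ √2 at distance ≥ 1 from T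
and pairwise ≥ 1. Then #H ≤ 6, and #H = 6 forces T to be the cuboctahedron (fcc pattern) or
anticuboctahedron (hcp pattern) up to a linear isometry. Geometry: a hole at radius r sees an empty
cap of angular radius arccos(r/2) ≥ 45° in T; the 45°-circle carries ≤ 4 directions pairwise ≥ 60°
apart, = 4 iff an exact unit square; Euler (12 vertices, k quadrilateral + t = 20 − 2k triangular
cells) with free-area bounds (regular unit square 1.359 sr, free part 0.335; equilateral
60°-triangle 0.5514 sr, free part 0.0566; total free area 4π − 12·2π(1 − cos 30°) = 2.463 sr) gives
7·0.335 + 6·0.0566 = 2.69 > 2.463 ⇒ k ≤ 6, and k = 6 exhausts the free area exactly ⇒ all cells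
regular ⇒ cubocta/anticubocta (cf. Hales2012_kissingConfigCongruent; area method of HalesDSP Lemmas
6.103–6.111, tree CountingSpheresRegularPolygon). Second-shell cap of OneCentreDomination
(icosahedral shells host 0 holes) and the equality case that lets the exact limit skip Hales 2012
Thm 1. [difficulty: M] -/
@[route_item "route-AtomisticToContinuum-SteepnessLadderOneCentre"]
def SquareHoleLemma : Prop :=
  ∀ T H : Finset (EuclideanSpace ℝ (Fin 3)), (∀ v ∈ T, ‖v‖ = 1) → (∀ v ∈ T, ∀ w ∈ T, v ≠ w → 1 ≤ dist v w) → T.card = 12 → (∀ y ∈ H, 1 ≤ ‖y‖ ∧ ‖y‖ ≤ Real.sqrt 2) → (∀ y ∈ H, ∀ v ∈ T, 1 ≤ dist y v) → (∀ y ∈ H, ∀ y' ∈ H, y ≠ y' → 1 ≤ dist y y') → H.card ≤ 6 ∧ (H.card = 6 → ∃ A : EuclideanSpace ℝ (Fin 3) →ₗᵢ[ℝ] EuclideanSpace ℝ (Fin 3), (↑T : Set (EuclideanSpace ℝ (Fin 3))) = A '' ↑Literature.Geometry.DiscreteGeometry.fccKissingPattern ∨ (↑T : Set (EuclideanSpace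 ℝ (Fin 3))) = A '' ↑Literature.Geometry.DiscreteGeometry.hcpKissingPattern)

/-- item stmt-AtomisticToContinuum-3620 · crux · rank 5 · closed · moot by None · by planner
why it might fail: As typed: two-way η-matching at the cut radius 5a/3 must survive vague limits, and local-to-global rigidity of RELAXED hcp(a,h) from 5a/3-environments must be reproved (tree covers ideal h only); a non-hcp structure with all 5a/3-environments hcp-isometric would refute it (none expected).
sources: Radin1991, BlancLewin2015, HalesDSP2012, Hales2012
[crux] EXACTIFICATION CASCADE on the ladder (card item S5 = card hull-exactification-cascade H1,
specialised so that no Hales-2012 fact is needed): for q ≥ 4, if V_q ground states are δ-separated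
and, for ONE hcp scale (a, h) and EVERY η > 0, the fraction of particles whose (5a/3)-neighbourhood
is not η-matched (both ways, up to a linear isometry) to the hcp(a,h) site environment tends to 0
along every ground-state sequence, then IsCrystallizing V_q 3. Plan (soft, no energy): δ-separation
⇒ ≤ C R³ particles per R-ball ⇒ by double counting some particle has no η_k-defect within R_k;
translate it to 0; vague compactness of δ-separated configurations, compactness of O(3) and
closedness of the matching predicate give along a diagonal subsequence a local limit S every point
of which has its (5a/3)-environment EXACTLY isometric to the hcp site environment; local-to-global
rigidity (anticuboctahedral first shells force alternation; ideal h: tree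
HalesDSP_layerPackings_holds; relaxed h: layers metrically distinguishable) ⇒ S ≅ hcpStacking a h =
(isometryImage ∘ translate of hcpPeriodicConfiguration).points, multiplicity 1; limits of limits are
limits (Radin's hull is closed). [difficulty: -/
@[route_item "route-AtomisticToContinuum-SteepnessLadderOneCentre"]
def ExactificationCascade : Prop :=
  ∀ q : ℕ, 4 ≤ q → ∀ δ a h : ℝ, 0 < δ → 0 < a → 0 < h → (∀ (N : ℕ) (x : Fin N → EuclideanSpace ℝ (Fin 3)), Literature.MathematicalPhysics.StatisticalMechanics.IsGroundState (fun r : ℝ => 1 / (2 * (q : ℝ)) * r⁻¹ ^ (2 * q) - 1 / (q : ℝ) * r⁻¹ ^ q) x → ∀ i j : Fin N, i ≠ j → δ ≤ dist (x i) (x j)) → (∀ η : ℝ, 0 < η → ∀ x : (N : ℕ) → (Fin N → EuclideanSpace ℝ (Fin 3)), (∀ N, Literature.MathematicalPhysics.StatisticalMechanics.IsGroundState (fun r : ℝ => 1 / (2 * (q : ℝ)) * r⁻¹ ^ (2 * q) - 1 / (q : ℝ) * r⁻¹ ^ q) (x N)) → Filter.Tendsto (fun N : ℕ => (Nat.card {i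 : Fin N // ¬ (∃ A : EuclideanSpace ℝ (Fin 3) →ₗᵢ[ℝ] EuclideanSpace ℝ (Fin 3), (∀ p ∈ Literature.MathematicalPhysics.StatisticalMechanics.hcpStacking a h, ‖p‖ ≤ 5 / 3 * a → ∃ j : Fin N, dist (x N j) (x N i + A p) ≤ η) ∧ (∀ j : Fin N, dist (x N j) (x N i) ≤ 5 / 3 * a → ∃ p ∈ Literature.MathematicalPhysics.StatisticalMechanics.hcpStacking a h, dist (x N j) (x N i + A p) ≤ η))} : ℝ) / N) Filter.atTop (nhds 0)) → Literature.MathematicalPhysics.StatisticalMechanics.IsCrystallizing (fun r : ℝ => 1 / (2 * (q : ℝ)) * r⁻¹ ^ (2 * q) - 1 / (q : ℝ) * r⁻¹ ^ q) 3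

/-- item stmt-AtomisticToContinuum-3621 · support · rank 9 · closed · moot by None · by planner
sources: LucaFriesecke2016, Theil2006, BlancLewin2015
[support] ZERO DENSITY OF DEFECTIVE CENTRES from coercive domination (glue X / OneCentreDomination →
ExactificationCascade): for q ≥ 4, δ-separated ground states + coercive domination at (q, δ, a, h) ⇒
for every η the fraction of η-defective centres → 0. Bookkeeping: E = −(1/(4q)) Σ_i Φ(x_i)
(two_mul_interactionEnergy); Σ_i T_g(x_i) = 0 (antisymmetry, finite S); 0 ≤ Φ − Φ^{≤R} ≤ ε_R(δ, q) →
0 (shell counting, q > 3); trial upper bound E(N) ≤ N e(hcp a h) + o(N) and e(hcp a h) = −Φ_hcp/(4q)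
(mirror symmetry of the two motif sites); hence γ(η)·#defective ≤ N(ε + ε_R) + o(N) with ε, R free
after γ. [difficulty: M] -/
@[route_item "route-AtomisticToContinuum-SteepnessLadderOneCentre"]
def ZeroDensityOfDefects : Prop :=
  ∀ q : ℕ, 4 ≤ q → ∀ δ a h : ℝ, 0 < δ → 0 < a → 0 < h → (∀ (N : ℕ) (x : Fin N → EuclideanSpace ℝ (Fin 3)), Literature.MathematicalPhysics.StatisticalMechanics.IsGroundState (fun r : ℝ => 1 / (2 * (q : ℝ)) * r⁻¹ ^ (2 * q) - 1 / (q : ℝ) * r⁻¹ ^ q) x → ∀ i j : Fin N, i ≠ j → δ ≤ dist (x i) (x j)) → (∀ η : ℝ, 0 < η → ∃ γ : ℝ, 0 < γ ∧ ∀ ε : ℝ, 0 < ε → ∀ R₀ : ℝ, ∃ R : ℝ, R₀ ≤ R ∧ ∃ g : EuclideanSpace ℝ (Fin 3) → Set (EuclideanSpace ℝ (Fin 3)) → ℝ, (∀ (v : EuclideanSpace ℝ (Fin 3)) (U : Set (EuclideanSpace ℝ (Fin 3))), R < ‖v‖ → g v U = 0) ∧ ∀ S : Set (EuclideanSpace ℝ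 (Fin 3)), (∀ x ∈ S, ∀ y ∈ S, x ≠ y → δ ≤ dist x y) → (∀ x ∈ S, ∀ y ∈ S, g (y - x) (((fun z : EuclideanSpace ℝ (Fin 3) => z - x) '' S) ∩ Metric.closedBall (0 : EuclideanSpace ℝ (Fin 3)) R) = - g (x - y) (((fun z : EuclideanSpace ℝ (Fin 3) => z - y) '' S) ∩ Metric.closedBall (0 : EuclideanSpace ℝ (Fin 3)) R)) ∧ ∀ x ∈ S, ((∑' y : ↥S, (if dist x (y : EuclideanSpace ℝ (Fin 3)) ≤ R then (2 * (dist x (y : EuclideanSpace ℝ (Fin 3)))⁻¹ ^ q - (dist x (y : EuclideanSpace ℝ (Fin 3)))⁻¹ ^ (2 * q)) else 0)) + (∑' y : ↥S, g ((y : EuclideanSpace ℝ (Fin 3)) - x) (((fun z : EuclideanSpace ℝ (Fin 3) => z - x) '' S) ∩ Metric.closedBall (0 : EuclideanSpace ℝ (Fin 3)) R))) ≤ (∑' p : ↥(Literature.MathematicalPhysics.StatisticalMechanics.hcpStacking a h), (2 * (‖(p : EuclideanSpace ℝ (Fin 3))‖)⁻¹ ^ q - (‖(p : EuclideanSpace ℝ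 (Fin 3))‖)⁻¹ ^ (2 * q))) + ε ∧ (¬ (∃ A : EuclideanSpace ℝ (Fin 3) →ₗᵢ[ℝ] EuclideanSpace ℝ (Fin 3), (∀ p ∈ Literature.MathematicalPhysics.StatisticalMechanics.hcpStacking a h, ‖p‖ ≤ 5 / 3 * a → ∃ y ∈ S, dist y (x + A p) ≤ η) ∧ (∀ y ∈ S, dist y x ≤ 5 / 3 * a → ∃ p ∈ Literature.MathematicalPhysics.StatisticalMechanics.hcpStacking a h, dist y (x + A p) ≤ η)) → ((∑' y : ↥S, (if dist x (y : EuclideanSpace ℝ (Fin 3)) ≤ R then (2 * (dist x (y : EuclideanSpace ℝ (Fin 3)))⁻¹ ^ q - (dist x (y : EuclideanSpace ℝ (Fin 3)))⁻¹ ^ (2 * q)) else 0)) + (∑' y : ↥S, g ((y : EuclideanSpace ℝ (Fin 3)) - x) (((fun z : EuclideanSpace ℝ (Fin 3) => z - x) '' S) ∩ Metric.closedBall (0 : EuclideanSpace ℝ (Fin 3)) R))) ≤ (∑' p : ↥(Literature.MathematicalPhysics.StatisticalMechanics.hcpStacking a h), (2 * (‖(p : EuclideanSpace ℝ (Fin 3))‖)⁻¹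 ^ q - (‖(p : EuclideanSpace ℝ (Fin 3))‖)⁻¹ ^ (2 * q))) + ε - γ)) → (∀ η : ℝ, 0 < η → ∀ x : (N : ℕ) → (Fin N → EuclideanSpace ℝ (Fin 3)), (∀ N, Literature.MathematicalPhysics.StatisticalMechanics.IsGroundState (fun r : ℝ => 1 / (2 * (q : ℝ)) * r⁻¹ ^ (2 * q) - 1 / (q : ℝ) * r⁻¹ ^ q) (x N)) → Filter.Tendsto (fun N : ℕ => (Nat.card {i : Fin N // ¬ (∃ A : EuclideanSpace ℝ (Fin 3) →ₗᵢ[ℝ] EuclideanSpace ℝ (Fin 3), (∀ p ∈ Literature.MathematicalPhysics.StatisticalMechanics.hcpStacking a h, ‖p‖ ≤ 5 / 3 * a → ∃ j : Fin N, dist (x N j) (x N i + A p) ≤ η) ∧ (∀ j : Fin N, dist (x N j) (x N i) ≤ 5 / 3 * a → ∃ p ∈ Literature.MathematicalPhysics.StatisticalMechanics.hcpStacking a h, dist (x N j) (x N i + A p) ≤ η))} : ℝ) / N) Filter.atTop (nhds 0))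

/-- item stmt-AtomisticToContinuum-3622 · support · rank 9 · closed · moot by None · by planner
sources: BlancLewin2015, Theil2006
[support] ENERGETIC CONJUNCT ON THE LADDER from the non-coercive part of domination: for q ≥ 4,
existence and δ-separation of V_q ground states + domination at (q, δ, a, h) ⇒
HasPeriodicGroundStateEnergy V_q 3 with P = hcpPeriodicConfiguration a h. Lower bound: transfers
cancel, Φ ≤ Φ^{≤R} + ε_R ⇒ E(N)/N ≥ e(hcp a h) − (ε + ε_R)/(4q) for all ε, R. Upper bound: E(N) ≤ N
e(Q) + o(N) for every periodic Q by trial blocks (tails summable, q ≥ 4 > 3;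
PeriodicConfigurationSums.summable_inv_pow_dist), in particular Q = hcp(a,h): E(N)/N → e(hcp a h)
and e(hcp a h) ≤ e(Q) for all Q (IsLeast) — no compactness over lattices needed, the dominating
configuration is explicit. At q = 6 existence is the proved fact
LennardJonesGroundStatesExist_holds. [difficulty: M] -/
@[route_item "route-AtomisticToContinuum-SteepnessLadderOneCentre"]
def DominationEnergyLimit : Prop :=
  ∀ q : ℕ, 4 ≤ q → ∀ δ a h : ℝ, 0 < δ → 0 < a → 0 < h → (∀ N : ℕ, ∃ x : Fin N → EuclideanSpace ℝ (Fin 3), Literature.MathematicalPhysics.StatisticalMechanics.IsGroundState (fun r : ℝ => 1 / (2 * (q : ℝ)) * r⁻¹ ^ (2 * q) - 1 / (q : ℝ) * r⁻¹ ^ q) x) → (∀ (N : ℕ) (x : Fin N → EuclideanSpace ℝ (Fin 3)), Literature.MathematicalPhysics.StatisticalMechanics.IsGroundState (fun r : ℝ => 1 / (2 * (q : ℝ)) * r⁻¹ ^ (2 * q) - 1 / (q : ℝ) * r⁻¹ ^ q) x → ∀ i j : Fin N, i ≠ j → δ ≤ dist (x i) (x j)) → (∀ ε : ℝ, 0 <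 ε → ∀ R₀ : ℝ, ∃ R : ℝ, R₀ ≤ R ∧ ∃ g : EuclideanSpace ℝ (Fin 3) → Set (EuclideanSpace ℝ (Fin 3)) → ℝ, (∀ (v : EuclideanSpace ℝ (Fin 3)) (U : Set (EuclideanSpace ℝ (Fin 3))), R < ‖v‖ → g v U = 0) ∧ ∀ S : Set (EuclideanSpace ℝ (Fin 3)), (∀ x ∈ S, ∀ y ∈ S, x ≠ y → δ ≤ dist x y) → (∀ x ∈ S, ∀ y ∈ S, g (y - x) (((fun z : EuclideanSpace ℝ (Fin 3) => z - x) '' S) ∩ Metric.closedBall (0 : EuclideanSpace ℝ (Fin 3)) R) = - g (x - y) (((fun z : EuclideanSpace ℝ (Fin 3) => z - y) '' S) ∩ Metric.closedBall (0 : EuclideanSpace ℝ (Fin 3)) R)) ∧ ∀ x ∈ S, ((∑' y : ↥S, (if dist x (y : EuclideanSpace ℝ (Fin 3)) ≤ R then (2 * (dist x (y : EuclideanSpace ℝ (Fin 3)))⁻¹ ^ q - (dist x (y : EuclideanSpace ℝ (Fin 3)))⁻¹ ^ (2 * q)) else 0)) + (∑' y : ↥S, g ((y : EuclideanSpace ℝ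 (Fin 3)) - x) (((fun z : EuclideanSpace ℝ (Fin 3) => z - x) '' S) ∩ Metric.closedBall (0 : EuclideanSpace ℝ (Fin 3)) R))) ≤ (∑' p : ↥(Literature.MathematicalPhysics.StatisticalMechanics.hcpStacking a h), (2 * (‖(p : EuclideanSpace ℝ (Fin 3))‖)⁻¹ ^ q - (‖(p : EuclideanSpace ℝ (Fin 3))‖)⁻¹ ^ (2 * q))) + ε) → Literature.MathematicalPhysics.StatisticalMechanics.HasPeriodicGroundStateEnergy (fun r : ℝ => 1 / (2 * (q : ℝ)) * r⁻¹ ^ (2 * q) - 1 / (q : ℝ) * r⁻¹ ^ q) 3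

/-- item stmt-AtomisticToContinuum-3623 · support · rank 9 · closed · moot by None · by planner
sources: Blanc2004, Xue1997, BlancLewin2015
[support] GROUND STATES ON THE LADDER EXIST AND ARE (1 − 2/q)-SEPARATED (card item S1, explicit
form): for q ≥ q₀, E(N) has minimisers for every N (binding inequalities, as
LennardJonesGroundStatesExist_holds) and every ground state of V_q has all distances ≥ 1 − 2/q
(removal argument: site energies ≤ 0 in a ground state; a pair at r ≤ 1 − 2/q contributes ≈ (e⁴/2 −
e²)/q ≈ 19.9/q against ≤ (#particles within ~1.3)·1/(2q) + tail of attraction, the count bounded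
after an a-priori crude separation as in LennardJonesMinimalDistance_holds). The tree's LJ facts are
q = 6 and qualitative; OneCentreDomination is stated at δ_q = 1 − 2/q, so the explicit constant is
needed. [difficulty: M] -/
@[route_item "route-AtomisticToContinuum-SteepnessLadderOneCentre"]
def LadderGroundStates : Prop :=
  ∃ q₀ : ℕ, ∀ q : ℕ, q₀ ≤ q → (∀ N : ℕ, ∃ x : Fin N → EuclideanSpace ℝ (Fin 3), Literature.MathematicalPhysics.StatisticalMechanics.IsGroundState (fun r : ℝ => 1 / (2 * (q : ℝ)) * r⁻¹ ^ (2 * q) - 1 / (q : ℝ) * r⁻¹ ^ q) x) ∧ (∀ (N : ℕ) (x : Fin N → EuclideanSpace ℝ (Fin 3)), Literature.MathematicalPhysics.StatisticalMechanics.IsGroundState (fun r : ℝ => 1 / (2 * (q : ℝ)) * r⁻¹ ^ (2 * q) - 1 / (q : ℝ) * r⁻¹ ^ q) x → ∀ i j : Fin N, i ≠ j → (1 - 2 / (q : ℝ)) ≤ dist (x i) (x j))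

/-- item stmt-AtomisticToContinuum-3624 · support · rank 9 · closed · moot by None · by planner
sources: FlatleyTheil2015, Theil2006, ELi2008, BeterminSamajTravenec2022, BlancLewin2015, arXiv:2604.19239
[support] THE RUNG THEOREM (corollary of OneCentreDomination + LadderGroundStates +
ZeroDensityOfDefects + ExactificationCascade + DominationEnergyLimit): there is q₀ such that for all
q ≥ q₀ the (2q, q) potential V_q = r^{−2q}/(2q) − r^{−q}/q crystallizes in ℝ³ in both Blanc–Lewin
senses, onto hcp at its optimal scale — the first crystallization theorem in ℝ³ for a pure, smooth,
LJ-shaped PAIR potential (FlatleyTheil2015 Thm 1.1 needs a three-body term; Theil2006 / ELi2008 are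
d = 2; BeterminSamajTravenec2022 treat lattice energies only; status: BlancLewin2015 §2.3,
Kreutz–Ziereis arXiv:2604.19239 §1). q₀ (and later the first failing q_c of the pointwise bound) is
the route's computable measure of progress toward q = 6. Support (corollary) so that staffing keys
on the cruxes. [difficulty: L] -/
@[route_item "route-AtomisticToContinuum-SteepnessLadderOneCentre"]
def LadderCrystallizes : Prop :=
  ∃ q₀ : ℕ, ∀ q : ℕ, q₀ ≤ q → Literature.MathematicalPhysics.StatisticalMechanics.HasPeriodicGroundStateEnergy (fun r : ℝ => 1 / (2 * (q : ℝ)) * r⁻¹ ^ (2 * q) - 1 / (q : ℝ) * r⁻¹ ^ q) 3 ∧ Literature.MathematicalPhysics.StatisticalMechanics.IsCrystallizing (fun r : ℝ => 1 / (2 * (q : ℝ)) * r⁻¹ ^ (2 * q) - 1 / (q : ℝ) * r⁻¹ ^ q) 3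

/-- item stmt-AtomisticToContinuum-3625 · assembly · rank 1 · closed · moot by None · by planner
sources: BlancLewin2015, FlatleyTheil2015
[assembly] OneCentreDominationLJ → ZeroDensityOfDefects → ExactificationCascade →
DominationEnergyLimit → Crystallization (q = 6 instances of the three ∀q-lemmas; V₆ = lennardJones). -/
@[route_item "route-AtomisticToContinuum-SteepnessLadderOneCentre"]
def Assembly : Prop :=
  OneCentreDominationLJ → ZeroDensityOfDefects → ExactificationCascade → DominationEnergyLimit → Literature.MathematicalPhysics.StatisticalMechanics.Crystallization

end Summit.AtomisticToContinuum.Crystallization.Theses.SteepnessLadderOneCentre
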